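import Summits.KontsevichZagierPeriods.KontsevichZagierPeriods.Theorems.SoloInformedAnNuCurve
import HarnessLib

/-!
# The sign-configuration calculus over `K`: the drop lemmas for the curve measure

Solo programme `solo-KontsevichZagierPeriods-informed`, session s111, step (γ-2) of PRES-RAT(2).
The **drop lemma** for the curve measure `ν♯` of `SoloInformedAnNuCurve` along a blow-up of the
same multiplicity:

* `soloInformed_nuCK_childK_lt` — multiplicity `m = k + 1 ≥ 2`, pure cone `c (X − θ)^m`: every
  child `child_F(θ, κ, λ)` (`κ, λ ≠ 0`) of the same multiplicity has `ν♯(child) < ν♯(F)`, provided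
  the **singular set** `{F = ∂₀F = ∂₁F = 0} ⊆ ℝ²` is finite (true for square-free `F`).  Along the
  maximal-contact curve `φ` one has `m + ord₀ F_child = ord₀ F` and `(m − 1) + ord₀ (∂₁F)_child =
  ord₀ ∂₁F` (by `∂₁ child_F = λ · child_{∂₁F}`); if `F ≡ 0` along `φ` then `∂₁F ≢ 0` along `φ`, for
  otherwise `∂₀F ≡ 0` along `φ` too (differentiate `F(s, φ s) ≡ 0`) and the branch would consist
  of singular points.  (THEOREM VG's drop lemma `soloInformed_nuK_childK_lt` needed an *isolated*
  zero instead.)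
The multiplicity-`1` drop (along the polar order `κ♯(F, D)`) and the combined measure `μ♯(F, D)`
are the next file.

References: J. Kollár, *Lectures on Resolution of Singularities* (2007), §1.10;
M. Kontsevich, D. Zagier, *Periods* (2001), §1.2.
-/

noncomputable section

open scoped BigOperators Topology ContDiff
open Filter Polynomial Set

namespace Summit.KontsevichZagierPeriods.KontsevichZagierPeriods.Theorems

variable {K : Type*} [Field K] [Algebra K ℝ]

/-! ### The singular set -/

/-- **The (real affine) singular set** of `F`: the common zeros of `F, ∂₀F, ∂₁F`. [this work] -/
def soloInformedSingSet (F : MvPolynomial (Fin 2) K) : Set (ℝ × ℝ) :=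
  {q | soloInformedEvalR F q = 0 ∧ soloInformedEvalR (MvPolynomial.pderiv 0 F) q = 0 ∧
    soloInformedEvalR (MvPolynomial.pderiv 1 F) q = 0}

/-- Membership in the singular set. [this work] -/
theorem soloInformed_mem_singSet (F : MvPolynomial (Fin 2) K) (q : ℝ × ℝ) :
    q ∈ soloInformedSingSet F ↔ soloInformedEvalR F q = 0 ∧
      soloInformedEvalR (MvPolynomial.pderiv 0 F) q = 0 ∧
      soloInformedEvalR (MvPolynomial.pderiv 1 F) q = 0 := Iff.rfl

/-- **A curve of zeros along which `∂₁F` vanishes consists of singular points.**  If `φ` is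
analytic at `0` and `F(s, φ s) = 0`, `∂₁F(s, φ s) = 0` for `s` near `0`, then `(s, φ s)` is a
singular point of `F` for `s` near `0`. [this work] -/
theorem soloInformed_eventually_mem_singSet {F : MvPolynomial (Fin 2) K} {φ : ℝ → ℝ}
    (hφ : AnalyticAt ℝ φ 0) (hJ : ∀ᶠ s in 𝓝 0, soloInformedEvalR F (s, φ s) = 0)
    (hJ' : ∀ᶠ s in 𝓝 0, soloInformedEvalR (MvPolynomial.pderiv 1 F) (s, φ s) = 0) :
    ∀ᶠ s in 𝓝 0, (s, φ s) ∈ soloInformedSingSet F := by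
  filter_upwards [hJ.eventually_nhds, hJ', hφ.eventually_analyticAt] with s hJs hJ's hφs
  have hJs0 : soloInformedEvalR F (s, φ s) = 0 := hJs.self_of_nhds
  refine ⟨hJs0, ?_, hJ's⟩
  -- differentiate `F(t, φ t) ≡ 0` at `t = s`
  have hFd : HasFDerivAt (soloInformedEvalR F) (fderiv ℝ (soloInformedEvalR F) (s, φ s)) (s, φ s) :=
    (soloInformed_analyticAt_evalR F _).differentiableAt.hasFDerivAt
  have hcomp := hFd.comp_hasDerivAt s ((hasDerivAt_id s).prodMk hφs.differentiableAt.hasDerivAt)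
  have hd : deriv (fun t => soloInformedEvalR F (t, φ t)) s =
      1 * soloInformedEvalR (MvPolynomial.pderiv 0 F) (s, φ s) +
        deriv φ s * soloInformedEvalR (MvPolynomial.pderiv 1 F) (s, φ s) := by
    rw [← soloInformed_fderiv_evalR_apply]
    exact hcomp.deriv
  have hzero : (fun t => soloInformedEvalR F (t, φ t)) =ᶠ[𝓝 s] fun _ => (0 : ℝ) := hJs
  rw [hzero.deriv_eq, deriv_const, hJ's, mul_zero, add_zero, one_mul] at hd
  exact hd.symm

/-- **An analytic branch inside a finite set is impossible**: if `(s, φ s)` lies in a finite set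
for all `s` near `0`, contradiction. [this work] -/
theorem soloInformed_not_eventually_mem_of_finite {S : Set (ℝ × ℝ)} (hS : S.Finite) (φ : ℝ → ℝ) :
    ¬ ∀ᶠ s in 𝓝 (0 : ℝ), (s, φ s) ∈ S := by
  intro h
  obtain ⟨ε, hε, hball⟩ := Metric.eventually_nhds_iff.1 h
  refine hS.not_infinite (Set.infinite_of_injOn_mapsTo (f := fun s : ℝ => (s, φ s))
    (fun a _ b _ hab => congrArg Prod.fst hab) (fun s hs => hball ?_) (Set.Ioo_infinite
      (show -ε < ε by linarith)))
  rw [Real.dist_eq, sub_zero]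
  exact abs_lt.2 ⟨hs.1, hs.2⟩

/-! ### The drop lemma for `ν♯` (multiplicity `≥ 2`) -/

/-- **The drop lemma for curve germs.**  For `F` of multiplicity `k + 1 ≥ 2` with pure cone
`c (X − θ)^{k+1}` (`c ≠ 0`) and finite singular set, every child germ `child_F(θ, κ, λ)`
(`κ ≠ 0`, `λ ≠ 0`) of the same multiplicity has strictly smaller curve measure `ν♯`. [this work] -/
theorem soloInformed_nuCK_childK_lt {F : MvPolynomial (Fin 2) K} {k : ℕ} (hk : 1 ≤ k)
    (hmult : soloInformedMultK F = k + 1) {c θ : K} (hc : c ≠ 0)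
    (hcone : soloInformedConePolyK F (k + 1) = C c * (X - C θ) ^ (k + 1))
    (hsing : (soloInformedSingSet F).Finite)
    {κ lam : K} (hκ : algebraMap K ℝ κ ≠ 0) (hlam : algebraMap K ℝ lam ≠ 0)
    (hmultC : soloInformedMultK (soloInformedChildK F (k + 1) θ κ lam) = k + 1) :
    soloInformedNuCK (soloInformedChildK F (k + 1) θ κ lam) < soloInformedNuCK F := by
  -- notation
  set m := k + 1 with hmdef
  set κ' := algebraMap K ℝ κ with hκ'
  set lam' := algebraMap K ℝ lam with hlam'
  set θ' := algebraMap K ℝ θ with hθ'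
  have hlamK : lam ≠ 0 := fun h => hlam (by rw [hlam', h, map_zero])
  have hκ0 : κ' ≠ 0 := hκ
  have hm := soloInformed_le_deg_of_multK_eq hmult
  set G := soloInformedChildK F m θ κ lam with hGdef
  set h := (MvPolynomial.pderiv 1)^[k] F with hhdef
  have hmaxF : soloInformedMaxContactK F = h := soloInformed_maxContactK_eq hmult
  have hm_h : ∀ b ∈ h.support, 1 ≤ b 0 + b 1 := by
    have h' := soloInformed_le_deg_iterate_pderiv hm k
    rwa [hmdef, Nat.add_sub_cancel_left] at h'
  have hmaxG : soloInformedMaxContactK G =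
      MvPolynomial.C (lam ^ k) * soloInformedChildK h 1 θ κ lam := by
    rw [soloInformed_maxContactK_eq hmultC, hGdef, soloInformed_iterate_pderiv_childK F hm θ κ lam
      (Nat.le_succ k), hmdef, Nat.add_sub_cancel_left]
  have hfac : ((m.factorial : ℕ) : ℝ) * algebraMap K ℝ c ≠ 0 :=
    mul_ne_zero (Nat.cast_ne_zero.2 (Nat.factorial_ne_zero _)) ((_root_.map_ne_zero _).2 hc)
  -- the maximal-contact curve of `F`
  have HF := soloInformed_contactOK_of_pureCone hmult hc hcone
  obtain ⟨φ, hφan, hφ0, hφev, hφder, hνF⟩ :=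
    soloInformed_exists_contactCurveC HF (soloInformed_evalR_maxContactK_zero hmult)
  rw [hmaxF] at hφev hφder
  rw [soloInformed_coeff_single_zero_maxContact_of_pow hm hcone,
    soloInformed_coeff_single_one_maxContact_of_pow hm hcone, map_neg, map_mul, map_mul,
    map_natCast] at hφder
  have hderiv : deriv φ 0 = θ' := by
    have h1 : ((m.factorial : ℕ) : ℝ) * algebraMap K ℝ c * (deriv φ 0 - θ') = 0 := by
      rw [hθ']; linear_combination hφder
    rcases mul_eq_zero.1 h1 with h2 | h2
    · exact absurd h2 hfac
    · linarith
  obtain ⟨hφ₁an, hφfac, hφ₁0⟩ := soloInformed_dslope_spec hφan hφ0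
  set φ₁ := dslope φ 0 with hφ₁def
  rw [hderiv] at hφ₁0
  -- the branch `ψ` of the maximal-contact polynomial of `G`
  set ψ : ℝ → ℝ := fun x => (φ₁ (κ' * x) - θ') / lam' with hψdef
  have hψ0 : ψ 0 = 0 := by simp [hψdef, hφ₁0]
  have hφ₁κ : AnalyticAt ℝ (fun x => φ₁ (κ' * x)) 0 :=
    AnalyticAt.comp_of_eq hφ₁an (analyticAt_const.mul analyticAt_id) (by simp)
  have hψan : AnalyticAt ℝ ψ 0 := (hφ₁κ.sub analyticAt_const).div analyticAt_const (by exact hlam)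
  have hkey : ∀ x : ℝ, κ' * x * (θ' + lam' * ψ x) = φ (κ' * x) := fun x => by
    rw [hψdef]
    simp only
    rw [mul_div_cancel₀ _ hlam, add_sub_cancel, hφfac (κ' * x)]
  have htendκ : Tendsto (fun x : ℝ => κ' * x) (𝓝 0) (𝓝 0) := by
    simpa using (continuous_const_mul κ').tendsto (0 : ℝ)
  have hψbr : ∀ᶠ x in 𝓝 0, soloInformedEvalR (soloInformedMaxContactK G) (x, ψ x) = 0 := by
    filter_upwards [htendκ.eventually hφev] with x hx
    by_cases hx0 : x = 0
    · rw [hx0, hψ0]; exact soloInformed_evalR_maxContactK_zero hmultC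
    · rw [hmaxG, soloInformed_evalR_C_mul]
      have hval := soloInformed_pow_mul_evalR_childK h hm_h θ κ lam x (ψ x)
      rw [pow_one, ← hκ', ← hθ', ← hlam', hkey x, hx] at hval
      rcases mul_eq_zero.1 hval with h1 | h1
      · exact absurd h1 (mul_ne_zero hκ0 hx0)
      · rw [h1, mul_zero]
  have hνG := soloInformed_nuCK_eq_of_branch
    (soloInformed_contactOK_childK_of_pureCone hc hcone hlamK hmultC)
    (soloInformed_evalR_maxContactK_zero hmultC) hψ0 hψan.continuousAt hψbr
  -- `∂₁ G = λ · child_{∂₁ F}`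
  set F' := MvPolynomial.pderiv 1 F with hF'def
  have hm' : ∀ b ∈ F'.support, k ≤ b 0 + b 1 := by
    have h' := soloInformed_le_deg_iterate_pderiv hm 1
    rw [Function.iterate_one, hmdef, Nat.add_sub_cancel] at h'
    exact h'
  have hG' : MvPolynomial.pderiv 1 G = MvPolynomial.C lam * soloInformedChildK F' k θ κ lam := by
    have h1 := soloInformed_iterate_pderiv_childK F hm θ κ lam (show 1 ≤ m by omega)
    simp only [Function.iterate_one, pow_one] at h1
    rw [show m - 1 = k by omega] at h1
    rw [hGdef]
    exact h1
  -- the orders along the branches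
  set J : ℝ → ℝ := fun s => soloInformedEvalR F (s, φ s) with hJdef
  set JG : ℝ → ℝ := fun x => soloInformedEvalR G (x, ψ x) with hJGdef
  set J' : ℝ → ℝ := fun s => soloInformedEvalR F' (s, φ s) with hJ'def
  set JG' : ℝ → ℝ := fun x => soloInformedEvalR (MvPolynomial.pderiv 1 G) (x, ψ x) with hJG'def
  have hJan : AnalyticAt ℝ J 0 := (soloInformed_analyticAt_evalR F _).comp₂ analyticAt_id hφan
  have hJGan : AnalyticAt ℝ JG 0 := (soloInformed_analyticAt_evalR G _).comp₂ analyticAt_id hψan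
  have hJ'an : AnalyticAt ℝ J' 0 := (soloInformed_analyticAt_evalR F' _).comp₂ analyticAt_id hφan
  have hJG'an : AnalyticAt ℝ JG' 0 :=
    (soloInformed_analyticAt_evalR (MvPolynomial.pderiv 1 G) _).comp₂ analyticAt_id hψan
  have hrel : (fun x : ℝ => (κ' * x) ^ m) * JG = fun x => J (κ' * x) := by
    funext x
    simp only [Pi.mul_apply, hJGdef, hJdef]
    rw [← hkey x]
    exact soloInformed_pow_mul_evalR_childK F hm θ κ lam x (ψ x)
  have hrel' : (fun x : ℝ => (κ' * x) ^ k) * JG' = fun x => J' (κ' * x) * lam' := by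
    funext x
    simp only [Pi.mul_apply, hJG'def, hJ'def]
    have hval := soloInformed_pow_mul_evalR_childK F' hm' θ κ lam x (ψ x)
    rw [← hκ', ← hθ', ← hlam', hkey x] at hval
    rw [hG', soloInformed_evalR_C_mul, ← hlam', ← hval]
    ring
  have hpowan : AnalyticAt ℝ (fun x : ℝ => (κ' * x) ^ m) 0 :=
    (analyticAt_const.mul analyticAt_id).pow m
  have hpowan' : AnalyticAt ℝ (fun x : ℝ => (κ' * x) ^ k) 0 :=
    (analyticAt_const.mul analyticAt_id).pow k
  have hJ'κan : AnalyticAt ℝ (fun x => J' (κ' * x)) 0 := by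
    have hg : AnalyticAt ℝ (fun x : ℝ => κ' * x) 0 := analyticAt_const.mul analyticAt_id
    have hJ'0 : AnalyticAt ℝ J' (κ' * 0) := by rw [mul_zero]; exact hJ'an
    exact hJ'0.comp hg
  have hord : (m : ℕ∞) + analyticOrderAt JG 0 = analyticOrderAt J 0 := by
    rw [← soloInformed_analyticOrderAt_comp_mul J hκ0, ← hrel, analyticOrderAt_mul hpowan hJGan,
      soloInformed_analyticOrderAt_mul_pow hκ0]
  have hord₁ : analyticOrderAt (fun x => J' (κ' * x) * lam') 0 = analyticOrderAt J' 0 := by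
    rw [soloInformed_analyticOrderAt_mul_const hJ'κan hlam,
      soloInformed_analyticOrderAt_comp_mul J' hκ0]
  have hord' : (k : ℕ∞) + analyticOrderAt JG' 0 = analyticOrderAt J' 0 := by
    rw [← hord₁, ← hrel', analyticOrderAt_mul hpowan' hJG'an,
      soloInformed_analyticOrderAt_mul_pow hκ0]
  rw [hνG, hνF, Prod.Lex.toLex_lt_toLex]
  by_cases htop : analyticOrderAt J 0 = ⊤
  · -- `F` vanishes along its maximal-contact curve: the second component drops by `k ≥ 1`
    right
    have hGtop : analyticOrderAt JG 0 = ⊤ := by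
      rw [htop, ENat.add_eq_top] at hord
      exact hord.resolve_left (ENat.coe_ne_top m)
    refine ⟨by rw [hGtop, htop], ?_⟩
    -- `∂₁F ≢ 0` along `φ`, by finiteness of the singular set
    have hJ'top : analyticOrderAt J' 0 ≠ ⊤ := by
      intro htop'
      exact soloInformed_not_eventually_mem_of_finite hsing φ
        (soloInformed_eventually_mem_singSet hφan (analyticOrderAt_eq_top.1 htop)
          (analyticOrderAt_eq_top.1 htop'))
    obtain ⟨N, hN⟩ := ENat.ne_top_iff_exists.1 hJ'top
    have hG'top : analyticOrderAt JG' 0 ≠ ⊤ := by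
      intro h'
      rw [h', add_top] at hord'
      exact hJ'top hord'.symm
    obtain ⟨n, hn⟩ := ENat.ne_top_iff_exists.1 hG'top
    rw [← hn, ← hN] at hord' ⊢
    rw [show (k : ℕ∞) + (n : ℕ∞) = ((k + n : ℕ) : ℕ∞) by push_cast; rfl] at hord'
    have hkn : k + n = N := by exact_mod_cast hord'
    exact Nat.cast_lt.2 (by omega)
  · -- the first component drops by `m ≥ 1`
    left
    obtain ⟨N, hN⟩ := ENat.ne_top_iff_exists.1 htop
    have hGtop : analyticOrderAt JG 0 ≠ ⊤ := by
      intro h'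
      rw [h', add_top] at hord
      exact htop hord.symm
    obtain ⟨n, hn⟩ := ENat.ne_top_iff_exists.1 hGtop
    rw [← hn, ← hN] at hord ⊢
    rw [show (m : ℕ∞) + (n : ℕ∞) = ((m + n : ℕ) : ℕ∞) by push_cast; rfl] at hord
    have hmn : m + n = N := by exact_mod_cast hord
    exact Nat.cast_lt.2 (by omega)

end Summit.KontsevichZagierPeriods.KontsevichZagierPeriods.Theorems
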